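import Literature.AlgebraicGeometry.Frobenioids.ArchimedeanPerfectionUnitTransportTwist
import Literature.AlgebraicGeometry.Frobenioids.ArchimedeanPerfectionRadialSectionGp
import Literature.AlgebraicGeometry.Frobenioids.ArchimedeanPerfectionRationalFunctionMonoidStr
import HarnessLib

/-!
# Frobenioids II, Thm. 3.6 (i), the clause "The Frobenioid `(C^Λ)^istr` is of [...] model type, with rational
# function monoid naturally isomorphic to `(Φ^fld)^Λ`" at `Λ = ℚ`, for THE perfection `C^ℚ = C^pf` of the
# archimedean Frobenioid — CLOSED

Mochizuki, *The geometry of Frobenioids II: poly-Frobenioids*, Kyushu J. Math. **62** (2008) 401–460, §3,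
Thm. 3.6 (i) p. 36 ll. 37–38 [cite: MochizukiFrdII2008, Thm 3.6 (i) p.36]; [FrdI] Prop. 4.4 (ii)/(iii) p. 83,
Thm. 5.2 (iv) p. 101 [cite: MochizukiFrdI2008, Thm. 5.2(iv) p.101].  Print reads (p. 36 ll. 37–38, manuscript of
June 2008): "(i) The Frobenioid `(C^Λ)^istr` is of isotropic, base-trivial, and model type, with rational function
monoid naturally isomorphic to `(Φ^fld)^Λ`;" — in the quotations of this file the bracketed ellipsis "[...]" elides
exactly the words "isotropic, base-trivial, and" (those clauses are typed on other rows of the sub-DAG, cf. e.g.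
`Thm36Sub.istrAll_Q_holds` for the isotropy of `C^ℚ`), and the instantiation `Λ := ℚ` (so that
`(Φ^fld)^Λ = (Φ^fld)^pf`, p. 36 ll. 32–36) is made OUTSIDE the quotation marks.  (v2, doc-only: quotation hygiene
of finding I16-n1 of referee pass I16 — elision and instantiation now marked; every declaration is
byte-identical to v1.)

abc-iut cell, layer L1, row M13-c3, P4 closer (seat abc-iut-w5-d246, on abc-iut-L1-t6's FILE B-arch p429564/p430113
and this seat's FILE A chain).  abc-iut-L1-t6's identification `isoOfSection X σ hσ : (Φ^gp × O_K^×)^pf ≃* O^×(X^birat)`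
is RE-KEYED on the `Φ^∡`-coordinate by the automorphism `[w] ↦ [ι_X^* w]^{X.idx}` of `(O_K^×)^pf` (`unitRekey`:
the Galois twist of the structure isomorphism `ι_X` of `X`, and the index of `X = (A, n)` — the normalisation
under which the unit germs ARE natural, `intertwines_unitsPerfEquiv_pow_pull`); with the radial section
`radialSectionGp` (S), its section property (hσ), the radial transport `intertwines_radialSectionGp` (T-rad) and
the unit transport (T-unit), [FrdI] Thm. 5.2 (iv)'s `RationalFunctionMonoidStr` of `C^pf` at `B = (Φ^fld)^pf`,
`Div_Q`, is inhabited (`rationalFunctionMonoidStr_Q`) and **`istrModel_Q_holds`**: abc-iut-L1-t9's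
`Thm36i_istrModel` for `C^ℚ = C^pf` at the printed datum holds outright.  Defs `unitRekey`, `rekey`,
`isoOfSectionTw`; nothing here bears on [IUTchIII] Cor. 3.12.
-/

noncomputable section

namespace Literature.AlgebraicGeometry.Frobenioids

open CategoryTheory Opposite
open scoped NNReal

universe v u

namespace ArchFrd

namespace Thm36Sub

variable {D : Type u} [Category.{v} D] {π : D ⥤ D0} {hF : PreFrobenioid.IsFrobenioid (C.toElem π)}

open PreFrobenioid PreFrobenioid.Perfection

section Rekey

variable (X : pfCat π hF)

/-- `twistUnit σ` is an involution. [cite: MochizukiFrdII2008, Def 3.1 (ii) p.23] -/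
theorem twistUnit_twistUnit (σ : Bool) (K : D0) (u : D0.unitScalars K) :
    D0.twistUnit σ K (D0.twistUnit σ K u) = u :=
  Subtype.ext (D0.galAct_galAct σ (u : ℂˣ))

/-- `(twistUnit σ)^pf` is an involution of `(O_K^×)^pf`. [cite: MochizukiFrdI2008, §0 p.11] -/
theorem map_twistUnit_involutive (σ : Bool) (K : D0) :
    Function.Involutive (Frobenioids.Perfection.map (D0.twistUnit σ K)) := fun x => by
  rw [← MonoidHom.comp_apply, ← Frobenioids.Perfection.map_comp,
    show (D0.twistUnit σ K).comp (D0.twistUnit σ K) = MonoidHom.id _ from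
      MonoidHom.ext (twistUnit_twistUnit σ K), Frobenioids.Perfection.map_id, MonoidHom.id_apply]

/-- **The re-keying of the `Φ^∡`-coordinate**: the automorphism `[w]^{1/c} ↦ [ι_X^* w]^{X.idx / c}` of the
uniquely divisible group `(O_K^×)^pf` (`ι_X^*` = the Galois twist of the structure isomorphism of `X`).
[cite: MochizukiFrdII2008, Thm 3.6 (v) p.37] -/
def unitRekey : Frobenioids.Perfection (D0.unitScalars (π.obj X.obj.snd)) ≃*
    Frobenioids.Perfection (D0.unitScalars (π.obj X.obj.snd)) :=
  (MulEquiv.ofBijective (Frobenioids.Perfection.map (D0.twistUnit (D0.Hom.twists X.obj.iso.hom) _))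
      (map_twistUnit_involutive _ _).bijective).trans
    (MulEquiv.ofBijective (powMonoidHom (X.idx : ℕ)) (Frobenioids.isPerfect_perfection.bijective_pow _ X.idx.pos))

/-- `unitRekey [w] = [(ι_X^* w)^{X.idx}]`. [cite: MochizukiFrdII2008, Thm 3.6 (v) p.37] -/
theorem unitRekey_of (w : D0.unitScalars (π.obj X.obj.snd)) :
    unitRekey X (Frobenioids.Perfection.of _ w) =
      Frobenioids.Perfection.of _ ((D0.twistUnit (D0.Hom.twists X.obj.iso.hom) _ w) ^ (X.idx : ℕ)) := by
  rw [map_pow]; rfl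

/-- The re-keying on `(Φ^gp × O_K^×)^pf` (identity on the `Φ^gp`-coordinate). [cite: MochizukiFrdII2008, Thm 3.6 (i) p.36] -/
def rekey : Frobenioids.Perfection (Algebra.GrothendieckGroup ((Φ π).obj (op X.obj.snd)) ×
      D0.unitScalars (π.obj X.obj.snd)) ≃*
    Frobenioids.Perfection (Algebra.GrothendieckGroup ((Φ π).obj (op X.obj.snd)) ×
      D0.unitScalars (π.obj X.obj.snd)) :=
  Frobenioids.Perfection.prodMulEquiv.trans <|
    ((MulEquiv.refl _).prodCongr (unitRekey X)).trans Frobenioids.Perfection.prodMulEquiv.symm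

/-- `rekey [(z, w)] = [(z, (ι_X^* w)^{X.idx})]`. [cite: MochizukiFrdII2008, Thm 3.6 (i) p.36] -/
theorem rekey_of (z : Algebra.GrothendieckGroup ((Φ π).obj (op X.obj.snd))) (w : D0.unitScalars (π.obj X.obj.snd)) :
    rekey X (Frobenioids.Perfection.of _ (z, w)) =
      Frobenioids.Perfection.of _ (z, (D0.twistUnit (D0.Hom.twists X.obj.iso.hom) _ w) ^ (X.idx : ℕ)) := by
  unfold rekey
  rw [MulEquiv.trans_apply, MulEquiv.trans_apply, Frobenioids.Perfection.prodMulEquiv_of]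
  change Frobenioids.Perfection.prodMulEquiv.symm
      (Frobenioids.Perfection.of _ z, unitRekey X (Frobenioids.Perfection.of _ w)) = _
  rw [unitRekey_of, Frobenioids.Perfection.prodMulEquiv_symm_of]

/-- The re-keying does not touch the `Φ^gp`-coordinate. [cite: MochizukiFrdII2008, Thm 3.6 (i) p.36] -/
theorem map_fst_rekey (b : Frobenioids.Perfection (Algebra.GrothendieckGroup ((Φ π).obj (op X.obj.snd)) ×
      D0.unitScalars (π.obj X.obj.snd))) :
    Frobenioids.Perfection.map (MonoidHom.fst _ _) (rekey X b) = Frobenioids.Perfection.map (MonoidHom.fst _ _) b := by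
  have h1 : (Frobenioids.Perfection.toProd (rekey X b)).1 = (Frobenioids.Perfection.toProd b).1 := by
    unfold rekey
    rw [MulEquiv.trans_apply, MulEquiv.trans_apply, Frobenioids.Perfection.toProd_symm_apply]
    rfl
  rwa [Frobenioids.Perfection.toProd_apply_eq, Frobenioids.Perfection.toProd_apply_eq] at h1

/-- **The re-keyed identification `(Φ^fld)^pf(d) ≃* O^×(X^birat)`**: abc-iut-L1-t6's `isoOfSection` precomposed
with `rekey`. [cite: MochizukiFrdII2008, Thm 3.6 (i) p.36] -/
def isoOfSectionTw (σ : PhiGp (pfStr π hF) X →* BiratUnits (pfStr π hF) (pf_isFrobenioid π hF) X)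
    (hσ : ∀ x, BiratUnits.divHom (pf_isFrobenioid π hF) X (σ x) = x) :
    Frobenioids.Perfection (Algebra.GrothendieckGroup ((Φ π).obj (op X.obj.snd)) × D0.unitScalars (π.obj X.obj.snd)) ≃*
      BiratUnits (pfStr π hF) (pf_isFrobenioid π hF) X :=
  (rekey X).trans (isoOfSection X σ hσ)

/-- `isoTw [(z, w)] = ι((unitsPerfEquiv [ι_X^* w])^{X.idx}) · σ((ι_Φ)^gp z)`. [cite: MochizukiFrdII2008, Thm 3.6 (i) p.36] -/
theorem isoOfSectionTw_of (σ : PhiGp (pfStr π hF) X →* BiratUnits (pfStr π hF) (pf_isFrobenioid π hF) X)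
    (hσ : ∀ x, BiratUnits.divHom (pf_isFrobenioid π hF) X (σ x) = x)
    (z : Algebra.GrothendieckGroup ((Φ π).obj (op X.obj.snd))) (w : D0.unitScalars (π.obj X.obj.snd)) :
    isoOfSectionTw X σ hσ (Frobenioids.Perfection.of _ (z, w)) =
      BiratUnits.unitsToBirat (pf_isFrobenioid π hF) X
          ((unitsPerfEquiv X (Frobenioids.Perfection.of _ (D0.twistUnit (D0.Hom.twists X.obj.iso.hom) _ w))) ^
            (X.idx : ℕ)) *
        σ (gpMap (Frobenioids.Perfection.of ((Φ π).obj (op X.obj.snd))) z) := by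
  unfold isoOfSectionTw
  rw [MulEquiv.trans_apply, rekey_of, isoOfSection_of, map_pow]
  congr 2
  exact (unitsPerfEquiv X).toMonoidHom.map_pow _ _

/-- **Compatibility with divisors** for the re-keyed identification (`div_iso`): units have trivial divisor, the
`Φ^gp`-coordinate is untouched. [cite: MochizukiFrdI2008, Prop. 4.4 (iii) p.83] -/
theorem divHom_isoOfSectionTw (σ : PhiGp (pfStr π hF) X →* BiratUnits (pfStr π hF) (pf_isFrobenioid π hF) X)
    (hσ : ∀ x, BiratUnits.divHom (pf_isFrobenioid π hF) X (σ x) = x)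
    (b : (perfectionFunctor (fieldMonoid (Φ π) π)).obj (op X.obj.snd)) :
    BiratUnits.divHom (pf_isFrobenioid π hF) X (isoOfSectionTw X σ hσ b) =
      ((divPerfection (fieldMonoidToGp (Φ π) π)).app (op X.obj.snd)).hom b := by
  have h := divHom_isoOfSection X σ hσ (rekey X b)
  rw [map_fst_rekey] at h
  exact h

end Rekey

/-- **Naturality of the re-keyed identification along linear arrows**, from `(T-rad)` for `σ` and `(T-unit)` in
the twisted/indexed normalisation. [cite: MochizukiFrdI2008, Prop. 2.2(ii) p.45] -/
theorem intertwines_isoOfSectionTw {X X' : pfCat π hF} (ψ : X ⟶ X') (hψ : IsLinear (pfStr π hF) ψ)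
    (σ : PhiGp (pfStr π hF) X →* BiratUnits (pfStr π hF) (pf_isFrobenioid π hF) X)
    (hσ : ∀ x, BiratUnits.divHom (pf_isFrobenioid π hF) X (σ x) = x)
    (σ' : PhiGp (pfStr π hF) X' →* BiratUnits (pfStr π hF) (pf_isFrobenioid π hF) X')
    (hσ' : ∀ x, BiratUnits.divHom (pf_isFrobenioid π hF) X' (σ' x) = x)
    (hrad : ∀ z : Algebra.GrothendieckGroup ((Φ π).obj (op X'.obj.snd)),
      BiratUnits.Intertwines (pf_isFrobenioid π hF) ψ
        (σ (gpMap (Frobenioids.Perfection.of ((Φ π).obj (op X.obj.snd)))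
          (gpMap ((Φ π).map (Base (pfStr π hF) ψ).op).hom z)))
        (σ' (gpMap (Frobenioids.Perfection.of ((Φ π).obj (op X'.obj.snd))) z)))
    (hunit : ∀ w : D0.unitScalars (π.obj X'.obj.snd),
      BiratUnits.Intertwines (pf_isFrobenioid π hF) ψ
        (BiratUnits.unitsToBirat (pf_isFrobenioid π hF) X ((unitsPerfEquiv X (Frobenioids.Perfection.of _
          (D0.twistUnit (D0.Hom.twists X.obj.iso.hom) _ (D0.unitPull (π.map (Base (pfStr π hF) ψ)) w)))) ^
            (X.idx : ℕ)))
        (BiratUnits.unitsToBirat (pf_isFrobenioid π hF) X' ((unitsPerfEquiv X' (Frobenioids.Perfection.of _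
          (D0.twistUnit (D0.Hom.twists X'.obj.iso.hom) _ w))) ^ (X'.idx : ℕ))))
    (b' : Frobenioids.Perfection (Algebra.GrothendieckGroup ((Φ π).obj (op X'.obj.snd)) ×
      D0.unitScalars (π.obj X'.obj.snd))) :
    BiratUnits.Intertwines (pf_isFrobenioid π hF) ψ
      (isoOfSectionTw X σ hσ (Frobenioids.Perfection.map ((fieldMonoid (Φ π) π).map (Base (pfStr π hF) ψ).op).hom b'))
      (isoOfSectionTw X' σ' hσ' b') := by
  have hsq := hasBiratSquares_of_isFrobenioid (pf_isFrobenioid π hF)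
  have hiso : IsOfIsotropicType (pfStr π hF) := istrAll_Q_holds π hF (fun h => by cases h)
  have key := BiratUnits.intertwines_perfection_of_forall_of hsq hiso hψ
    (biratUnits_pow_injective X σ hσ)
    ((isoOfSectionTw X σ hσ).toMonoidHom.comp
      (Frobenioids.Perfection.map ((fieldMonoid (Φ π) π).map (Base (pfStr π hF) ψ).op).hom))
    (isoOfSectionTw X' σ' hσ').toMonoidHom (fun p => ?_) b'
  · exact key
  · obtain ⟨z, w⟩ := p
    have e1 := isoOfSectionTw_of X σ hσ (gpMap ((Φ π).map (Base (pfStr π hF) ψ).op).hom z)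
      (D0.unitPull (π.map (Base (pfStr π hF) ψ)) w)
    have e2 := isoOfSectionTw_of X' σ' hσ' z w
    have key2 := BiratUnits.Intertwines.mul hsq (hunit w) (hrad z)
    rw [← e1, ← e2] at key2
    exact key2

variable (π)

/-- **[FrdI] Thm. 5.2 (iv)'s structure for `C^ℚ = C^pf` at the printed `Λ = ℚ` datum — INHABITED**:
`RationalFunctionMonoidStr (C^pf → F_{Φ^pf}) hPf ((Φ^fld)^pf) Div_Q`. [cite: MochizukiFrdI2008, Prop. 4.4(ii) p.83] -/
theorem rationalFunctionMonoidStr_Q (hF : PreFrobenioid.IsFrobenioid (C.toElem π)) :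
    Nonempty (RationalFunctionMonoidStr (pfStr π hF) (pf_isFrobenioid π hF)
      (perfectionFunctor (fieldMonoid (Φ π) π)) (divPerfection (fieldMonoidToGp (Φ π) π))) :=
  ⟨{ iso := fun X => isoOfSectionTw X (radialSectionGp π hF X) (divHom_radialSectionGp π hF X)
     div_iso := fun X b =>
       divHom_isoOfSectionTw X (radialSectionGp π hF X) (divHom_radialSectionGp π hF X) b
     natural := fun X X' ψ hψ b' =>
       intertwines_isoOfSectionTw ψ hψ (radialSectionGp π hF X) (divHom_radialSectionGp π hF X)
         (radialSectionGp π hF X') (divHom_radialSectionGp π hF X') (intertwines_radialSectionGp π hF ψ hψ)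
         (intertwines_unitsPerfEquiv_pow_pull (pf_isFrobenioid π hF) ψ hψ) b' }⟩

/-- **[FrdII] Theorem 3.6 (i), the clause "The Frobenioid `(C^Λ)^istr` is of [...] model type, with rational
function monoid naturally isomorphic to `(Φ^fld)^Λ`" (p. 36 ll. 37–38; "[...]" = "isotropic, base-trivial, and",
typed on other rows) at `Λ = ℚ`, for THE perfection `C^ℚ = C^pf` of the archimedean Frobenioid — UNCONDITIONAL**:
`(C^pf)^istr ≌` the model Frobenioid of `(Φ^pf, (Φ^fld)^pf, Div_Q)`, compatibly with the structure functors
(abc-iut-L1-t9's `Thm36i_istrModel` at the printed datum). [cite: MochizukiFrdII2008, Thm 3.6 (i) p.36] -/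
theorem istrModel_Q_holds (hF : PreFrobenioid.IsFrobenioid (C.toElem π)) :
    Thm36i_istrModel (pfStr π hF)
      (ModelFrobenioid.toElem (PreFrobenioid.Perfection.ops hF).monFunctor
        (perfectionFunctor (fieldMonoid (Φ π) π)) (divPerfection (fieldMonoidToGp (Φ π) π))) := by
  obtain ⟨R⟩ := rationalFunctionMonoidStr_Q π hF
  exact istrModel_Q_of_str π hF R

end Thm36Sub

end ArchFrd

end Literature.AlgebraicGeometry.Frobenioids

end
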